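import Summits.Ventures.HodgeRepro2.HostAPI.Carriers.AlgebraicGeometry.Motives.AbelianVariety
import Summits.Ventures.HodgeRepro2.HostAPI.Carriers.AlgebraicGeometry.Motives.Varieties
import Summits.Ventures.HodgeRepro2.HostAPI.Carriers.AlgebraicGeometry.HodgeTheory.HodgeConjecture

namespace HostAPI.HCCM

/-- The Hodge conjecture for complex abelian varieties of CM type: for every abelian variety `A` over `ℂ`
(a proper, geometrically integral group scheme over `Spec ℂ`) whose underlying scheme is smooth projective
of dimension `A.dim`, and whose rational endomorphism algebra `End(A) ⊗ ℚ` contains a commutative reduced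
`ℚ`-subalgebra of `ℚ`-dimension `2 · A.dim`, the complex points of `A` carry a Hodge model and every rational
cohomology class of Hodge type `(p, p)` on them is algebraic (`HodgeConjectureFor A.dim A.X`). -/
def Statement : Prop :=
  ∀ (A : HostAPI.Carriers.AlgebraicGeometry.Motives.AbelianVariety ℂ), HostAPI.Carriers.AlgebraicGeometry.Motives.IsSmoothProjective A.dim A.X → (∃ S : Subalgebra ℚ A.endAlgebra, IsReduced ↥S ∧ (∀ x ∈ S, ∀ y ∈ S, x * y = y * x) ∧ Module.finrank ℚ ↥S = 2 * A.dim) → HostAPI.Carriers.AlgebraicGeometry.HodgeTheory.HodgeConjectureFor A.dim A.X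

end HostAPI.HCCM
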